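import Mathlib

/-!
# Crux `WordLengthQP` (stmt-ValiantsHypothesis-6623), line `Sketch`, stub `stub_twoProducts`

The general rung-1 skeleton of the ε-order ladder is cheap for two-term sums.  For two products
`P₁ = ∏ ls₁`, `P₂ = ∏ ls₂` of S-affine letters `C a * X v + C b` over `ℂ[x̄]`, the width-2 word
over `ℂ[ε][x̄]` (`ε = Polynomial.X`, `♯ = MvPolynomial.map Polynomial.C` the coefficient
embedding `ℂ[x̄] → ℂ[ε][x̄]`)

  `T₀₁(1) · ∏_{ℓ ∈ ls₁} diag(ℓ♯, 1) · diag(ε, 1) · ∏_{ℓ' ∈ ls₂} diag(1, ℓ'♯) · T₁₀(ε)`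

has S-affine letters, length `|ls₁| + |ls₂| + 3`, and `(0,0)` entry EXACTLY `ε · (P₁ + P₂)♯`:
`T₀₁(1) · diag(P₁♯, 1) = !![P₁♯, 1; 0, 1]`, `· diag(ε, 1) = !![ε P₁♯, 1; 0, 1]`,
`· diag(1, P₂♯) = !![ε P₁♯, P₂♯; 0, P₂♯]`, `· T₁₀(ε) = !![ε P₁♯ + ε P₂♯, P₂♯; ε P₂♯, P₂♯]`.
One rank-1 skeleton letter (`diag(0, 1)` at `ε = 0`) and non-unit determinants (`diag(ℓ, 1)`) give
two-term sums for free, so the unit-determinant (`E₂`) picture under-estimates order one.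
-/

-- `Summit.ValiantsHypothesis.ValiantsHypothesis.…` is the tree's mandated single-conjunct layout
-- (Sub = Summit), so the duplicated namespace component is intended.
set_option linter.dupNamespace false

noncomputable section

open MvPolynomial

namespace Summit.ValiantsHypothesis.ValiantsHypothesis.Cruxes.WordLengthQP.EpsOrderLadder

/-- `SAff[σ | x]` (local notation, not a definition): the entry `x ∈ ℂ[ε][x̄]` is S-affine over
`ℂ[ε]`, i.e. `x = C b` or `x = C a * X v + C b` with `a b ∈ ℂ[ε]` — the letter condition of the
ladder `EpsOrderLadder`. -/
local notation3 (prettyPrint := false) "SAff[" σ " | " x "]" =>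
  ((∃ b' : Polynomial ℂ, (x : MvPolynomial σ (Polynomial ℂ)) = MvPolynomial.C b') ∨
    (∃ (a' b' : Polynomial ℂ) (v' : σ), (x : MvPolynomial σ (Polynomial ℂ)) =
      MvPolynomial.C a' * MvPolynomial.X v' + MvPolynomial.C b'))

/-- A `2 × 2` matrix with four S-affine entries has S-affine entries. [folklore] -/
theorem twoProducts_entries {σ : Type} {a b c d : MvPolynomial σ (Polynomial ℂ)}
    (ha : SAff[σ | a]) (hb : SAff[σ | b]) (hc : SAff[σ | c]) (hd : SAff[σ | d]) :
    ∀ i j : Fin 2, SAff[σ | !![a, b; c, d] i j] := by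
  intro i j
  fin_cases i <;> fin_cases j
  exacts [by simpa using ha, by simpa using hb, by simpa using hc, by simpa using hd]

/-- A constant `C b` over `ℂ[ε]` is S-affine. [folklore] -/
theorem twoProducts_sAffine_C {σ : Type} (b : Polynomial ℂ) : SAff[σ | MvPolynomial.C b] :=
  Or.inl ⟨b, rfl⟩

/-- `0` over `ℂ[ε][x̄]` is S-affine (`0 = C 0`). [folklore] -/
theorem twoProducts_sAffine_zero {σ : Type} : SAff[σ | 0] :=
  Or.inl ⟨0, by simp⟩

/-- `1` over `ℂ[ε][x̄]` is S-affine (`1 = C 1`). [folklore] -/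
theorem twoProducts_sAffine_one {σ : Type} : SAff[σ | 1] :=
  Or.inl ⟨1, by simp⟩

/-- Coefficient extension `♯ : ℂ[x̄] → ℂ[ε][x̄]` of an S-affine letter `C a * X v + C b` over `ℂ` is
the S-affine letter `C (C a) * X v + C (C b)` over `ℂ[ε]`. [folklore] -/
theorem twoProducts_sAffine_map {σ : Type} {ℓ : MvPolynomial σ ℂ}
    (h : ∃ (a b : ℂ) (v : σ), ℓ = MvPolynomial.C a * MvPolynomial.X v + MvPolynomial.C b) :
    SAff[σ | MvPolynomial.map Polynomial.C ℓ] := by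
  obtain ⟨a, b, v, rfl⟩ := h
  exact Or.inr ⟨Polynomial.C a, Polynomial.C b, v, by
    simp [MvPolynomial.map_C, MvPolynomial.map_X]⟩

/-- `∏_{ℓ ∈ ls} diag(ℓ♯, 1) = diag((∏ ls)♯, 1)`. [folklore] -/
theorem twoProducts_prod_diagLeft {σ : Type} (ls : List (MvPolynomial σ ℂ)) :
    (ls.map fun ℓ => !![MvPolynomial.map Polynomial.C ℓ, 0;
      0, (1 : MvPolynomial σ (Polynomial ℂ))]).prod =
      !![MvPolynomial.map Polynomial.C ls.prod, 0; 0, 1] := by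
  induction ls with
  | nil => simp [Matrix.one_fin_two]
  | cons ℓ ls ih =>
    simp only [List.map_cons, List.prod_cons, ih, map_mul, Matrix.mul_fin_two]
    simp

/-- `∏_{ℓ ∈ ls} diag(1, ℓ♯) = diag(1, (∏ ls)♯)`. [folklore] -/
theorem twoProducts_prod_diagRight {σ : Type} (ls : List (MvPolynomial σ ℂ)) :
    (ls.map fun ℓ => !![(1 : MvPolynomial σ (Polynomial ℂ)), 0;
      0, MvPolynomial.map Polynomial.C ℓ]).prod =
      !![1, 0; 0, MvPolynomial.map Polynomial.C ls.prod] := by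
  induction ls with
  | nil => simp [Matrix.one_fin_two]
  | cons ℓ ls ih =>
    simp only [List.map_cons, List.prod_cons, ih, map_mul, Matrix.mul_fin_two]
    simp

/-- **stub_twoProducts** (seat c4, registered): for any two products `P₁ = ∏ ls₁`, `P₂ = ∏ ls₂` of
S-affine letters, the S-affine word `T₀₁(1) · ∏ diag(ℓ,1) · diag(ε,1) · ∏ diag(1,ℓ') · T₁₀(ε)` over
`ℂ[ε][x̄]` has `(0,0)` entry EXACTLY `ε · (P₁ + P₂)` — an order-1 program of length
`|ls₁| + |ls₂| + 3` (versus `2·5·4^d` through the sl₂ ladder of `rungOne_universal`): one rank-1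
skeleton letter (`diag(0,1)`) and non-unit determinants (`diag(ℓ,1)`) give two-term sums for free,
so the unit-determinant (E₂) picture of seat c3 under-estimates order 1. [folklore] -/
theorem stub_twoProducts {σ : Type} (ls₁ ls₂ : List (MvPolynomial σ ℂ))
    (h : ∀ ℓ ∈ ls₁ ++ ls₂, ∃ (a b : ℂ) (v : σ),
      ℓ = MvPolynomial.C a * MvPolynomial.X v + MvPolynomial.C b) :
    ∃ ms : List (Matrix (Fin 2) (Fin 2) (MvPolynomial σ (Polynomial ℂ))),
      ms.length = ls₁.length + ls₂.length + 3 ∧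
      (∀ m ∈ ms, ∀ i j : Fin 2, (∃ b : Polynomial ℂ, m i j = MvPolynomial.C b) ∨
        (∃ (a b : Polynomial ℂ) (v : σ),
          m i j = MvPolynomial.C a * MvPolynomial.X v + MvPolynomial.C b)) ∧
      ms.prod 0 0 = MvPolynomial.C Polynomial.X *
        MvPolynomial.map Polynomial.C (ls₁.prod + ls₂.prod) := by
  refine ⟨[!![1, 1; 0, 1]] ++
    ls₁.map (fun ℓ => !![MvPolynomial.map Polynomial.C ℓ, 0; 0, 1]) ++
    [!![MvPolynomial.C Polynomial.X, 0; 0, 1]] ++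
    ls₂.map (fun ℓ => !![1, 0; 0, MvPolynomial.map Polynomial.C ℓ]) ++
    [!![1, 0; MvPolynomial.C Polynomial.X, 1]], ?_, ?_, ?_⟩
  · simp only [List.length_append, List.length_singleton, List.length_map]
    omega
  · intro m hm
    simp only [List.mem_append, List.mem_singleton, List.mem_map] at hm
    rcases hm with (((rfl | ⟨ℓ, hℓ, rfl⟩) | rfl) | ⟨ℓ, hℓ, rfl⟩) | rfl
    · exact twoProducts_entries twoProducts_sAffine_one twoProducts_sAffine_one
        twoProducts_sAffine_zero twoProducts_sAffine_one
    · exact twoProducts_entries (twoProducts_sAffine_map (h ℓ (List.mem_append_left _ hℓ)))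
        twoProducts_sAffine_zero twoProducts_sAffine_zero twoProducts_sAffine_one
    · exact twoProducts_entries (twoProducts_sAffine_C _) twoProducts_sAffine_zero
        twoProducts_sAffine_zero twoProducts_sAffine_one
    · exact twoProducts_entries twoProducts_sAffine_one twoProducts_sAffine_zero
        twoProducts_sAffine_zero (twoProducts_sAffine_map (h ℓ (List.mem_append_right _ hℓ)))
    · exact twoProducts_entries twoProducts_sAffine_one twoProducts_sAffine_zero
        (twoProducts_sAffine_C _) twoProducts_sAffine_one
  · simp only [List.prod_append, List.prod_singleton, twoProducts_prod_diagLeft,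
      twoProducts_prod_diagRight, Matrix.mul_fin_two, map_add]
    simp
    ring

end Summit.ValiantsHypothesis.ValiantsHypothesis.Cruxes.WordLengthQP.EpsOrderLadder
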